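import Literature.NumberTheory.QuadraticFields.KroneckerSplitting
import Literature.NumberTheory.QuadraticFields.HeegnerCondition
import Literature.NumberTheory.EllipticCurves.HeegnerPointsImaginaryQuadraticProofs
import HarnessLib

/-!
# Crux `PrintCFram.BottomClassIndexLawFiveLe` (stmt-BirchSwinnertonDyer-20372), line `eisenstein-resource-bdp-line` (registry v19):
# THE HEEGNER FAMILY `t² − 4n` — on the discriminants `d·F² = t² − 4n` every prime `q ∣ n` with `q ∤ t` SPLITS in the quadratic
# field of discriminant `d`; so «`M ∣ n`, `gcd(t, M) = 1`» delivers ALL the local conditions of Stub C (every prime of `M = 2·p·m`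
# split — including the Eisenstein prime `p` itself), and `t` odd, `t² < 4n`, `d ≠ −3` deliver «`d` odd, imaginary, `d < −4`»
# (cell `bsd-print-cfram`, width seat `bsd-line-cfram-p1-w8` g4; THEOREMS ONLY, `--supports` 20372; BSD is not proved by any of this)

HONEST FRAMING. Elementary arithmetic of quadratic fields; nothing about BSD, no stub closed, no definition, no named fact. Purpose:
registry v19's Stub C (`stub_heegnerField_of_unitClassFactor`) asks, for each class member, for an imaginary quadratic `K''` with
`d_{K''}` odd `< −4` in which every prime of `N_W` (⊆ primes of `p·m`, see `…HeegnerFieldSupplySocket`) splits and whose field factor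
`B_{k,(χ_e ε_{K''})~}/k` is a `p`-adic unit. The printed supply theorems for such fields with a non-vanishing-mod-`p` condition
(Wiles 2015, Beckwith–Raum–Richter 2024: `k = 1`; Bruinier 1999 / Ono–Skinner 1998: conditions only at primes `∤ 4Np`) do not
control the prime `p` one is working modulo. On the classical CM family of discriminants `t² − 4n` (the discriminants of the
characteristic polynomials `X² − tX + n`, the index set of the Eichler–Selberg / Hurwitz–Kronecker / Cohen class-number relations)
the control is free: `q ∣ n`, `q ∤ t` ⟹ `t² − 4n ≡ t² ≢ 0 (mod q)` is a non-zero square, so `(d/q) = +1`; and `2 ∣ n`, `t` odd ⟹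
`d ≡ 1 (mod 8)`. This is the device by which Horie (1990, «Trace formulae and imaginary quadratic fields», `k = 1`) obtains
prescribed splitting together with `p ∤ h`; the companion file uses it to re-index Stub C's search space by `(n, t)` with `2pm ∣ n`.

Contents: §1 the Legendre symbol of `d` at an odd `q ∣ n`, `q ∤ t` is `+1` and `q` splits; §2 `d ≡ 1 (mod 8)` and `2` splits when
`2 ∣ n`, `t` odd; §3 every prime of `M` splits when `M ∣ n`, `gcd(t, M) = 1`, and the Heegner hypothesis for any `N` whose primes
divide `n` and not `t`; §4 the side conditions: `d < 0` (from `t² < 4n`), `K` imaginary quadratic, `d` odd (from `t` odd), `d < −4`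
(from `d ≠ −3`). beyond-print theorem: NO. References: [Cox2013] §7.A (7.2)–(7.3) (orders of discriminant `(t² − 4n)/f²`), Prop. 5.16
(splitting ⟺ `(d_K/p) = 1`); [GrossLMS1991] §1 (Heegner hypothesis); Marcus, *Number Fields*, Ch. 3 Thm. 25.
-/

set_option autoImplicit false
-- summit-side namespace `Summit.BirchSwinnertonDyer.BirchSwinnertonDyer.…` (single-conjunct summit, D-0017 layout)
set_option linter.dupNamespace false

noncomputable section

namespace Summit.BirchSwinnertonDyer.BirchSwinnertonDyer.Theorems.PrintCFram.HeegnerFamily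

open NumberField Module Literature.NumberTheory.QuadraticFields Literature.NumberTheory.EllipticCurves

/-! ## §1 Odd primes `q ∣ n`, `q ∤ t` split in the field of discriminant `d`, `d·F² = t² − 4n` -/

/-- **`(d/q) = +1` for an odd prime `q ∣ n`, `q ∤ t`, when `d·F² = t² − 4n`:** modulo `q` the identity reads `d·F² ≡ t² ≢ 0`, so
`F ≢ 0` and `d ≡ (t/F)²` is a non-zero square. [cite: Cox2013, §7.A (7.2)–(7.3) and Prop. 5.16] -/
theorem legendreSym_eq_one_of_mul_sq_eq {q : ℕ} [Fact q.Prime] {d F t n : ℤ}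
    (h : d * F ^ 2 = t ^ 2 - 4 * n) (hqn : (q : ℤ) ∣ n) (hqt : ¬ (q : ℤ) ∣ t) : legendreSym q d = 1 := by
  have ht : (t : ZMod q) ≠ 0 := by rwa [Ne, ZMod.intCast_zmod_eq_zero_iff_dvd]
  have hn : (n : ZMod q) = 0 := by rwa [ZMod.intCast_zmod_eq_zero_iff_dvd]
  have hmod : (d : ZMod q) * (F : ZMod q) ^ 2 = (t : ZMod q) ^ 2 := by
    have e := congrArg (Int.cast : ℤ → ZMod q) h
    push_cast at e
    rw [e, hn, mul_zero, sub_zero]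
  have hF : (F : ZMod q) ≠ 0 := by
    intro hF
    rw [hF, zero_pow two_ne_zero, mul_zero] at hmod
    exact ht (pow_eq_zero_iff two_ne_zero |>.mp hmod.symm)
  have hd : (d : ZMod q) = ((t : ZMod q) * (F : ZMod q)⁻¹) ^ 2 := by
    rw [mul_pow, inv_pow, ← hmod, mul_assoc, mul_inv_cancel₀ (pow_ne_zero 2 hF), mul_one]
  have hd0 : (d : ZMod q) ≠ 0 := by
    rw [hd]; exact pow_ne_zero 2 (mul_ne_zero ht (inv_ne_zero hF))
  exact (legendreSym.eq_one_iff q hd0).mpr ⟨(t : ZMod q) * (F : ZMod q)⁻¹, by rw [hd, sq]⟩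

variable {K : Type*} [Field K] [NumberField K]

/-- **An odd prime `q ∣ n`, `q ∤ t` SPLITS in the quadratic field `K` with `d_K·F² = t² − 4n`** (two primes of `𝓞 K` above `q`), by
§1's Legendre symbol and the decomposition law `KroneckerSplitting.ncard_primesOver_eq_two_iff_legendreSym`.
[cite: Cox2013, Prop. 5.16 and §7.A (7.3)] -/
theorem ncard_primesOver_eq_two_of_discr_mul_sq_eq (h2 : finrank ℚ K = 2) {q : ℕ} (hq : q.Prime) (hq2 : q ≠ 2)
    {F t n : ℤ} (h : NumberField.discr K * F ^ 2 = t ^ 2 - 4 * n) (hqn : (q : ℤ) ∣ n) (hqt : ¬ (q : ℤ) ∣ t) :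
    ((Ideal.span {(q : ℤ)}).primesOver (𝓞 K)).ncard = 2 := by
  haveI := Fact.mk hq
  exact (Quadratic.ncard_primesOver_eq_two_iff_legendreSym h2 hq2).mpr (legendreSym_eq_one_of_mul_sq_eq h hqn hqt)

/-! ## §2 The prime `2`: `2 ∣ n`, `t` odd ⟹ `d ≡ 1 (mod 8)` ⟹ `2` splits -/

/-- An odd square is `≡ 1 (mod 8)`. [folklore] -/
theorem sq_emod_eight_of_odd {t : ℤ} (ht : Odd t) : ∃ i : ℤ, t ^ 2 = 8 * i + 1 := by
  obtain ⟨a, rfl⟩ := ht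
  obtain ⟨i, hi⟩ := Int.even_mul_succ_self a
  exact ⟨i, by linear_combination 4 * hi⟩

/-- **`d ≡ 1 (mod 8)` when `d·F² = t² − 4n` with `t` odd and `n` even:** `t² ≡ 1 (mod 8)` and `8 ∣ 4n`, so `d·F² ≡ 1 (mod 8)`; `F` is odd
(else `4 ∣ d·F²`), `F² ≡ 1 (mod 8)`, hence `d ≡ 1 (mod 8)`. [cite: Cox2013, §7.A (7.2)–(7.3)] -/
theorem emod_eight_eq_one_of_mul_sq_eq {d F t n : ℤ} (h : d * F ^ 2 = t ^ 2 - 4 * n) (ht : Odd t) (hn : Even n) :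
    d % 8 = 1 := by
  obtain ⟨i, hi⟩ := sq_emod_eight_of_odd ht
  obtain ⟨c, rfl⟩ := hn
  rcases Int.even_or_odd F with hF | hF
  · obtain ⟨b, rfl⟩ := hF
    have e : 4 * (d * b ^ 2) = 8 * i + 1 - 4 * (c + c) := by rw [← hi, ← h]; ring
    omega
  · obtain ⟨j, hj⟩ := sq_emod_eight_of_odd hF
    have e : 8 * (d * j) + d = 8 * i + 1 - 4 * (c + c) := by
      rw [← hi, ← h, show d * F ^ 2 = d * (8 * j + 1) by rw [hj]]; ring
    omega

/-- **`2` SPLITS in the quadratic field `K` with `d_K·F² = t² − 4n`, `t` odd, `n` even** (decomposition law at `2`: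
`KroneckerSplitting.ncard_primesOver_two_eq_two_iff`, `d_K ≡ 1 (mod 8)`). [cite: Cox2013, Prop. 5.16 and §7.A (7.3)] -/
theorem ncard_primesOver_two_eq_two_of_discr_mul_sq_eq (h2 : finrank ℚ K = 2)
    {F t n : ℤ} (h : NumberField.discr K * F ^ 2 = t ^ 2 - 4 * n) (ht : Odd t) (hn : Even n) :
    ((Ideal.span {(2 : ℤ)}).primesOver (𝓞 K)).ncard = 2 :=
  (Quadratic.ncard_primesOver_two_eq_two_iff h2).mpr (emod_eight_eq_one_of_mul_sq_eq h ht hn)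

/-! ## §3 Every prime of `M` splits when `M ∣ n` and `gcd(t, M) = 1`; the Heegner hypothesis -/

/-- **Every prime `q ∣ n` with `q ∤ t` splits in `K`** (`d_K·F² = t² − 4n`), `q = 2` included. [cite: Cox2013, Prop. 5.16 and §7.A (7.3)] -/
theorem ncard_primesOver_eq_two_of_dvd_of_not_dvd (h2 : finrank ℚ K = 2) {F t n : ℤ}
    (h : NumberField.discr K * F ^ 2 = t ^ 2 - 4 * n) {q : ℕ} (hq : q.Prime) (hqn : (q : ℤ) ∣ n) (hqt : ¬ (q : ℤ) ∣ t) :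
    ((Ideal.span {(q : ℤ)}).primesOver (𝓞 K)).ncard = 2 := by
  by_cases hq2 : q = 2
  · subst hq2
    exact ncard_primesOver_two_eq_two_of_discr_mul_sq_eq h2 h (Int.not_even_iff_odd.mp fun ⟨r, hr⟩ ↦ hqt ⟨r, by omega⟩)
      (even_iff_two_dvd.mpr (by exact_mod_cast hqn))
  · exact ncard_primesOver_eq_two_of_discr_mul_sq_eq h2 hq hq2 h hqn hqt

/-- **Every prime of `M` splits in `K` when `M ∣ n` and `t` is coprime to `M`** (`d_K·F² = t² − 4n`): the form used with `M = 2·p·m`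
by the Heegner-family supply statement. [cite: Cox2013, Prop. 5.16 and §7.A (7.3)] -/
theorem ncard_primesOver_eq_two_of_dvd_of_isCoprime (h2 : finrank ℚ K = 2) {F t n : ℤ}
    (h : NumberField.discr K * F ^ 2 = t ^ 2 - 4 * n) {M : ℕ} (hMn : (M : ℤ) ∣ n) (hMt : IsCoprime t (M : ℤ))
    {q : ℕ} (hq : q.Prime) (hqM : q ∣ M) :
    ((Ideal.span {(q : ℤ)}).primesOver (𝓞 K)).ncard = 2 := by
  refine ncard_primesOver_eq_two_of_dvd_of_not_dvd h2 h hq ((Int.natCast_dvd_natCast.mpr hqM).trans hMn) fun hqt ↦ ?_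
  have hunit : IsUnit (q : ℤ) := hMt.isUnit_of_dvd' hqt (Int.natCast_dvd_natCast.mpr hqM)
  have h1 := Int.isUnit_iff.mp hunit
  have h2q := hq.two_le
  omega

/-- **THE HEEGNER HYPOTHESIS ON THE FAMILY.** If `d_K·F² = t² − 4n` and every prime of `N` divides `n` and not `t`, then every prime
of `N` splits in `K`: `SatisfiesHeegnerHypothesis N K`. [cite: GrossLMS1991, §1 (p. 235)] [cite: Cox2013, Prop. 5.16 and §7.A (7.3)] -/
theorem satisfiesHeegnerHypothesis_of_discr_mul_sq_eq (h2 : finrank ℚ K = 2) {F t n : ℤ}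
    (h : NumberField.discr K * F ^ 2 = t ^ 2 - 4 * n) {N : ℕ}
    (hN : ∀ q : ℕ, q.Prime → q ∣ N → (q : ℤ) ∣ n ∧ ¬ (q : ℤ) ∣ t) : SatisfiesHeegnerHypothesis N K :=
  fun q hq hqN ↦ ncard_primesOver_eq_two_of_dvd_of_not_dvd h2 h hq (hN q hq hqN).1 (hN q hq hqN).2

/-! ## §4 The side conditions: imaginary, odd, `< −4` -/

/-- **`d < 0` when `d·F² = t² − 4n` and `t² < 4n`.** [folklore] -/
theorem neg_of_mul_sq_eq {d F t n : ℤ} (h : d * F ^ 2 = t ^ 2 - 4 * n) (hlt : t ^ 2 < 4 * n) : d < 0 := by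
  by_contra hd
  push Not at hd
  have : 0 ≤ d * F ^ 2 := mul_nonneg hd (sq_nonneg F)
  omega

/-- **`K` is IMAGINARY quadratic when `d_K·F² = t² − 4n` with `t² < 4n`** (`IsImaginaryQuadratic K`: degree `2` and no real place,
⟺ `d_K < 0`). [cite: Cox2013, §7.A (p. 119, real vs imaginary by the sign of d_K)] -/
theorem isImaginaryQuadratic_of_discr_mul_sq_eq (h2 : finrank ℚ K = 2) {F t n : ℤ}
    (h : NumberField.discr K * F ^ 2 = t ^ 2 - 4 * n) (hlt : t ^ 2 < 4 * n) : IsImaginaryQuadratic K :=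
  isImaginaryQuadratic_iff_discr_neg.mpr ⟨h2, neg_of_mul_sq_eq h hlt⟩

/-- **`d` is odd when `d·F² = t² − 4n` with `t` odd.** [folklore] -/
theorem odd_of_mul_sq_eq {d F t n : ℤ} (h : d * F ^ 2 = t ^ 2 - 4 * n) (ht : Odd t) : Odd d := by
  have hodd : Odd (d * F ^ 2) := by
    rw [h]
    obtain ⟨i, hi⟩ := sq_emod_eight_of_odd ht
    exact ⟨4 * i - 2 * n, by rw [hi]; ring⟩
  exact (Int.odd_mul.mp hodd).1

/-- **`d_K < −4` when `d_K·F² = t² − 4n` with `t` odd, `t² < 4n` and `d_K ≠ −3`:** `d_K` is odd, negative and `≡ 0, 1 (mod 4)`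
(Stickelberger), so `d_K ∈ {−3, −7, −11, …}`. [cite: Cox2013, §7.A and Thm. 7.7 (i) (the orders of discriminant −3, −4)] -/
theorem discr_lt_neg_four_of_discr_mul_sq_eq (h2 : finrank ℚ K = 2) {F t n : ℤ}
    (h : NumberField.discr K * F ^ 2 = t ^ 2 - 4 * n) (ht : Odd t) (hlt : t ^ 2 < 4 * n) (h3 : NumberField.discr K ≠ -3) :
    NumberField.discr K < -4 := by
  have hneg := neg_of_mul_sq_eq h hlt
  have hodd := odd_of_mul_sq_eq h ht
  have h4 := Quadratic.discr_emod_four (K := K) h2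
  obtain ⟨r, hr⟩ := hodd
  omega

end Summit.BirchSwinnertonDyer.BirchSwinnertonDyer.Theorems.PrintCFram.HeegnerFamily

end
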